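import Literature.NumberTheory.GaloisCohomology.Howard2004.DualityDatumLocalValueTowerProofs
import HarnessLib

/-!
# The socle reading `(ℤ/p^{k+1})[p] ≅ ℤ/p` of a bi-additive pairing killed by `p` (proofs file)

Topic `Algebra/Module` (generic finite-abelian-group algebra; no definition, no named fact, no instance, no `sorry`).
Cell `pub/bsd-print-x9` (seat `bsd-line-x10b-p1` LEAD g14, brick «C451-CL Q7-READ», `--supports stmt-BirchSwinnertonDyer-22642`).

WHY.  The class-level Cassels–Tate pairing of the cell's port of Howard's Prop. 1.4.1 is `ℤ/p^{k+1}`-valued (ONE level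
`p^{k+1} ≥ p^{t+2}` of local Tate duality serves all tower levels), while the tower entry
`prop141_casselsTate_skewPairing_atLevel_printIntended_of_forall_full_towerZModLeftKernelPairings` wants a `ℤ/p`-valued
pairing; its values on `H¹(K, T̄)`-defects are killed by `p`, and NO additive map `ℤ/p^{k+1} → ℤ/p` is injective on the
socle when `k ≥ 1` — so the reading goes UP: `j : ℤ/p → ℤ/p^{k+1}`, `c ↦ p^k c`, is injective with image the `p`-torsion.

* **`exists_zmod_reading_of_prime_smul_eq_zero`** — for `P : A →+ B →+ ℤ/p^{k+1}` with `p • P a y = 0`, there are a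
  bi-additive `Q : A →+ B →+ ℤ/p` and an INJECTIVE `j : ℤ/p →+ ℤ/p^{k+1}` with `j (Q a y) = P a y`; hence `Q a y = 0 ↔ P a y = 0`
  and every additive identity among values of `P` is one among values of `Q`.

References: [MilneADT2006] Ch. I §0 (finite abelian groups, `Hom(–, ℚ/ℤ)` of `n`-torsion groups).
-/

set_option autoImplicit false

namespace Literature.Algebra.Module

open Function

/-- **Socle reading**: a bi-additive pairing into `ℤ/p^{k+1}` all of whose values are killed by `p` is `j ∘ Q` for a
bi-additive `ℤ/p`-valued `Q` and the INJECTIVE map `j : ℤ/p → ℤ/p^{k+1}`, `c ↦ p^k c` (the socle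
`(ℤ/p^{k+1})[p] = p^k ℤ/p^{k+1} ≅ ℤ/p`); in particular `Q a y = 0 ↔ P a y = 0` and every additive identity of `P` is one of
`Q`. [cite: MilneADT2006, Ch. I §0 (finite abelian groups)] -/
theorem exists_zmod_reading_of_prime_smul_eq_zero {A B : Type*} [AddCommGroup A] [AddCommGroup B]
    (p : ℕ) [hp : Fact p.Prime] (k : ℕ) (P : A →+ B →+ ZMod (p ^ (k + 1))) (hP : ∀ a y, p • P a y = 0) :
    ∃ (Q : A →+ B →+ ZMod p) (j : ZMod p →+ ZMod (p ^ (k + 1))),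
      Injective j ∧ ∀ a y, j (Q a y) = P a y := by
  classical
  haveI : NeZero (p ^ (k + 1)) := ⟨pow_ne_zero _ hp.out.ne_zero⟩
  -- `j : ℤ/p → ℤ/p^{k+1}`, `c ↦ p^k • c`
  let j : ZMod p →+ ZMod (p ^ (k + 1)) :=
    ZMod.lift p ⟨(AddMonoidHom.id (ZMod (p ^ (k + 1)))).comp
        ((zmultiplesHom (ZMod (p ^ (k + 1)))) ((p : ZMod (p ^ (k + 1))) ^ k)), by
      change ((p : ℕ) : ℤ) • ((p : ZMod (p ^ (k + 1))) ^ k) = 0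
      rw [natCast_zsmul, nsmul_eq_mul, ← pow_succ', ← Nat.cast_pow, ZMod.natCast_self]⟩
  have hj : ∀ c : ℤ, j (c : ZMod p) = c • ((p : ZMod (p ^ (k + 1))) ^ k) := fun c ↦ by
    change (ZMod.lift p _) ((Int.castAddHom (ZMod p)) c) = _
    rw [ZMod.lift_castAddHom]
    rfl
  have hjinj : Injective j := by
    rw [injective_iff_map_eq_zero]
    intro c hc
    obtain ⟨c', rfl⟩ := ZMod.intCast_surjective c
    rw [hj] at hc
    -- `c' • p^k = 0` in `ℤ/p^{k+1}` ⇒ `p ∣ c'`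
    rw [ZMod.intCast_zmod_eq_zero_iff_dvd]
    have h1 : ((c' * (p : ℤ) ^ k : ℤ) : ZMod (p ^ (k + 1))) = 0 := by
      rw [Int.cast_mul, Int.cast_pow, Int.cast_natCast, ← zsmul_eq_mul]
      exact hc
    rw [ZMod.intCast_zmod_eq_zero_iff_dvd, Nat.cast_pow, pow_succ] at h1
    exact Int.dvd_of_mul_dvd_mul_right (pow_ne_zero _ (Int.natCast_ne_zero.mpr hp.out.ne_zero))
      (by rw [mul_comm ((p : ℤ) ^ k)] at h1; exact h1)
  -- every value of `P` is in the image of `j`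
  have hval : ∀ a y, ∃ c : ZMod p, j c = P a y := fun a y ↦ by
    obtain ⟨z, hz⟩ := ZMod.exists_eq_pow_smul_of_prime_smul_eq_zero p k (P a y) (hP a y)
    obtain ⟨z', rfl⟩ := ZMod.intCast_surjective z
    refine ⟨(z' : ZMod p), ?_⟩
    rw [hj, hz, nsmul_eq_mul, zsmul_eq_mul, Nat.cast_pow, mul_comm]
  choose q hq using hval
  refine ⟨AddMonoidHom.mk' (fun a ↦ AddMonoidHom.mk' (q a) fun y y' ↦ hjinj ?_) fun a a' ↦ ?_, j, hjinj,
    fun a y ↦ hq a y⟩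
  · rw [map_add, hq, hq, hq, map_add]
  · ext y
    change q (a + a') y = q a y + q a' y
    apply hjinj
    rw [map_add, hq, hq, hq, map_add, AddMonoidHom.add_apply]

end Literature.Algebra.Module
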